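import Literature.NumberTheory.Irrationality.Fischler2002.Theoreme32OrderThreeProofs
import Literature.NumberTheory.Irrationality.Fischler2002.Theoreme32WreathProofs
import HarnessLib

/-!
# Fischler 2002, Théorème 3.2 — brick IV: for `n ≥ 4` the group `⟨σ, ψ, φ⟩` has order `72` (a faithful `𝔖₃ ≀ ℤ/2`)

Topic `Literature/NumberTheory/Irrationality/Fischler2002`. PROOFS ONLY (no definition, no statement, no discharge): fourth brick
toward the named fact `theoreme32` of `RhinViolaGroupsGeneral.lean` —

> [Fischler2002Polyzetas, §3 Théorème 3.2] « pour `n ≥ 4`, ce groupe est isomorphe à `(𝔖₃ × 𝔖₃) ⋊ ℤ/2ℤ`, donc d'ordre 72 »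
> (`paper:arxiv-math_0202064` p. 4; [Fischler2003RhinViola, §3.4 Th. 6]).

For every `n ≥ 4` we prove `Nat.card ⟨σ', ψ', φ'⟩ = 72 = rvGroupOrder n` for ANY permutations `σ', ψ', φ'` of `{p // InE n p}` with
underlying maps `sigma`, `psi n`, `phi n` (`card_closure_eq_of_four_le`), UNIFORMLY in `n`. ROUTE (the seat's reconnaissance
`HOME/ct-1/g33/THEOREME32-RECON.md`): on `𝓔` the group PERMUTES the six forms `f₀ = a₁, f₁ = a₂ (= b₁), f₂ = b₂, f₃ = a_n,
f₄ = a_{n−1}, f₅ = c_n (= b_n)` — two blocks `{f₀,f₁,f₂}`, `{f₃,f₄,f₅}` — through `σ ↦ (0 2)`, `φ ↦ (4 5)`, `ψ ↦ (0 3)(1 4)(2 5)`, which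
generate the full imprimitive group `𝔖₃ ≀ ℤ/2 ≤ 𝔖₆` of order `72` (`card_closure_wreath` of the sibling
`Theoreme32WreathProofs.lean`: its 72 elements listed as words and counted by the kernel); every group element acts through a unique such
`π`, reverses the middle coordinates `a_k ↦ a_{n+1−k}` (`3 ≤ k ≤ n−2`) exactly when `π` exchanges the two blocks, and fixes the inert
coordinates; since the `b_k` are determined on `𝓔` by the chain relations `a_k + b_{k+1} = a_{k+2} + b_{k+2}`, the element is recovered
from `π` — an INJECTIVE homomorphism onto the group of order `72`. The forms ride on a FREE function symbol `f` with its defining table.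
Cell `pub-zeta5`, seat ct-1 g33, 2026-08-28.

HONEST FRAMING (cell pub-zeta5): systematic search; no irrationality claim unless certified — pure bookkeeping of a printed group
structure; nothing about `ζ(5)`.
-/

namespace Literature.NumberTheory.Irrationality.Fischler2002

namespace Theoreme32

open Equiv

section OrderFour

variable {n : ℕ} {f : Fin 6 → Exponents → ℤ}
  (hf : ∀ (x : Fin 6) (p : Exponents), f x p = ![p.a 1, p.a 2, p.b 2, p.a n, p.a (n - 1), p.c n] x)
  {gσ gψ gφ : Perm {p : Exponents // InE n p}}

/-! ### The six forms, the middle coordinates, and the action of the generators -/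

include hf in
/-- `σ` acts on the six forms through `(0 2)`, preserves the blocks without exchange, and fixes the middle `a_k`.
[cite: Fischler2002Polyzetas, §3 Théorème 3.2 (n ≥ 4)] -/
theorem rel4_sigma (hn : 4 ≤ n) (hσ : ∀ p, (gσ p).1 = sigma p.1) :
    (∀ x (p : {p : Exponents // InE n p}), f x (gσ p).1 = f ((swap (0 : Fin 6) 2) x) p.1) ∧
    (∀ x : Fin 6, ((swap (0 : Fin 6) 2) x).val < 3 ↔ (x.val < 3 ↔ ((swap (0 : Fin 6) 2) 0).val < 3)) ∧
    (∀ (p : {p : Exponents // InE n p}) (k : ℕ), 3 ≤ k → k ≤ n - 2 →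
      (gσ p).1.a k = p.1.a (if 3 ≤ ((swap (0 : Fin 6) 2) 0).val then n + 1 - k else k)) := by
  refine ⟨fun x p => ?_, by decide, fun p k hk3 hkn => ?_⟩
  · obtain ⟨-, -, h4⟩ := p.2
    obtain ⟨h21, -, -⟩ := h4 hn
    have hn1 : n ≠ 1 := by omega
    have hn2 : n ≠ 2 := by omega
    have hm1 : n - 1 ≠ 1 := by omega
    have hm2 : n - 1 ≠ 2 := by omega
    rw [hσ p]
    fin_cases x <;> simp [hf, sigma, Equiv.swap_apply_def, hn1, hn2, hm1, hm2, h21]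
  · rw [hσ p, show (swap (0 : Fin 6) 2) 0 = 2 from rfl]
    simp only [sigma, if_neg (show k ≠ 1 by omega), if_neg (show k ≠ 2 by omega), Fin.val_two,
      if_neg (show ¬ (3 ≤ 2) by norm_num)]

include hf in
/-- `φ` acts on the six forms through `(4 5)`, preserves the blocks without exchange, and fixes the middle `a_k`.
[cite: Fischler2002Polyzetas, §3 Théorème 3.2 (n ≥ 4)] -/
theorem rel4_phi (hn : 4 ≤ n) (hφ : ∀ p, (gφ p).1 = phi n p.1) :
    (∀ x (p : {p : Exponents // InE n p}), f x (gφ p).1 = f ((swap (4 : Fin 6) 5) x) p.1) ∧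
    (∀ x : Fin 6, ((swap (4 : Fin 6) 5) x).val < 3 ↔ (x.val < 3 ↔ ((swap (4 : Fin 6) 5) 0).val < 3)) ∧
    (∀ (p : {p : Exponents // InE n p}) (k : ℕ), 3 ≤ k → k ≤ n - 2 →
      (gφ p).1.a k = p.1.a (if 3 ≤ ((swap (4 : Fin 6) 5) 0).val then n + 1 - k else k)) := by
  refine ⟨fun x p => ?_, by decide, fun p k hk3 hkn => ?_⟩
  · have h1 : (1 : ℕ) ≠ n - 1 := by omega
    have h2 : (2 : ℕ) ≠ n - 1 := by omega
    have h2' : (2 : ℕ) ≠ n := by omega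
    have hnn : n ≠ n - 1 := by omega
    rw [hφ p]
    fin_cases x <;> simp [hf, phi, Equiv.swap_apply_def, h1, h2, h2', hnn]
  · rw [hφ p, show (swap (4 : Fin 6) 5) 0 = 0 from rfl]
    simp only [phi, if_neg (show k ≠ n - 1 by omega), Fin.val_zero, if_neg (show ¬ (3 ≤ 0) by norm_num)]

include hf in
/-- `ψ` acts on the six forms through `(0 3)(1 4)(2 5)` (using `b_n = c_n`, `a₂ = b₁` on `𝓔`), EXCHANGES the blocks, and reverses the
middle `a_k ↦ a_{n+1−k}`. [cite: Fischler2002Polyzetas, §3 Théorème 3.2 (n ≥ 4)] -/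
theorem rel4_psi (hn : 4 ≤ n) (hψ : ∀ p, (gψ p).1 = psi n p.1) :
    (∀ x (p : {p : Exponents // InE n p}),
      f x (gψ p).1 = f ((swap (0 : Fin 6) 3 * swap (1 : Fin 6) 4 * swap (2 : Fin 6) 5) x) p.1) ∧
    (∀ x : Fin 6, ((swap (0 : Fin 6) 3 * swap (1 : Fin 6) 4 * swap (2 : Fin 6) 5) x).val < 3 ↔
      (x.val < 3 ↔ ((swap (0 : Fin 6) 3 * swap (1 : Fin 6) 4 * swap (2 : Fin 6) 5) 0).val < 3)) ∧
    (∀ (p : {p : Exponents // InE n p}) (k : ℕ), 3 ≤ k → k ≤ n - 2 →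
      (gψ p).1.a k = p.1.a (if 3 ≤ ((swap (0 : Fin 6) 3 * swap (1 : Fin 6) 4 * swap (2 : Fin 6) 5) 0).val
        then n + 1 - k else k)) := by
  refine ⟨fun x p => ?_, by decide, fun p k hk3 hkn => ?_⟩
  · obtain ⟨-, -, h4⟩ := p.2
    obtain ⟨h21, hbn, -⟩ := h4 hn
    have e1 : n + 1 - 1 = n := by omega
    have e2 : n + 1 - 2 = n - 1 := by omega
    have e3 : n + 2 - 2 = n := by omega
    have e4 : n + 1 - n = 1 := by omega
    have e5 : n + 1 - (n - 1) = 2 := by omega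
    have c1 : 1 ≤ 1 ∧ 1 ≤ n := ⟨le_rfl, by omega⟩
    have c2 : 1 ≤ 2 ∧ 2 ≤ n := ⟨by norm_num, by omega⟩
    have c5 : 1 ≤ n - 1 ∧ n - 1 ≤ n := ⟨by omega, by omega⟩
    rw [hψ p]
    fin_cases x <;> simp [hf, psi, Equiv.swap_apply_def, e1, e2, e3, e4, e5, c1, c2, c5, h21, hbn]
    intro h; omega
  · rw [hψ p, show (swap (0 : Fin 6) 3 * swap (1 : Fin 6) 4 * swap (2 : Fin 6) 5) 0 = 3 from rfl]
    simp only [psi, if_pos (show 1 ≤ k ∧ k ≤ n from ⟨by omega, by omega⟩), if_pos (show 3 ≤ ((3 : Fin 6) : ℕ) by decide)]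

/-! ### The relation is multiplicative -/

/-- Products. [cite: Fischler2002Polyzetas, §3 Théorème 3.2 (n ≥ 4)] -/
theorem rel4_mul {g h : Perm {p : Exponents // InE n p}} {π τ : Perm (Fin 6)}
    (hg : (∀ x p, f x (g p).1 = f (π x) p.1) ∧ (∀ x : Fin 6, (π x).val < 3 ↔ (x.val < 3 ↔ (π 0).val < 3)) ∧
      ∀ (p : {p : Exponents // InE n p}) (k : ℕ), 3 ≤ k → k ≤ n - 2 →
        (g p).1.a k = p.1.a (if 3 ≤ (π 0).val then n + 1 - k else k))
    (hh : (∀ x p, f x (h p).1 = f (τ x) p.1) ∧ (∀ x : Fin 6, (τ x).val < 3 ↔ (x.val < 3 ↔ (τ 0).val < 3)) ∧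
      ∀ (p : {p : Exponents // InE n p}) (k : ℕ), 3 ≤ k → k ≤ n - 2 →
        (h p).1.a k = p.1.a (if 3 ≤ (τ 0).val then n + 1 - k else k)) :
    (∀ x p, f x ((g * h) p).1 = f ((τ * π) x) p.1) ∧
      (∀ x : Fin 6, ((τ * π) x).val < 3 ↔ (x.val < 3 ↔ ((τ * π) 0).val < 3)) ∧
      ∀ (p : {p : Exponents // InE n p}) (k : ℕ), 3 ≤ k → k ≤ n - 2 →
        ((g * h) p).1.a k = p.1.a (if 3 ≤ ((τ * π) 0).val then n + 1 - k else k) := by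
  obtain ⟨hg1, hg2, hg3⟩ := hg
  obtain ⟨hh1, hh2, hh3⟩ := hh
  obtain ⟨hb, hs⟩ := blocks_mul hg2 hh2
  refine ⟨fun x p => by rw [Perm.mul_apply, hg1, hh1, Perm.mul_apply], hb, fun p k hk3 hkn => ?_⟩
  rw [Perm.mul_apply, hg3 (h p) k hk3 hkn]
  by_cases hπ : 3 ≤ (π 0).val
  · rw [if_pos hπ, hh3 p (n + 1 - k) (by omega) (by omega)]
    by_cases hτ : 3 ≤ (τ 0).val
    · rw [if_pos hτ, show n + 1 - (n + 1 - k) = k by omega, if_neg (by rw [hs]; tauto)]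
    · rw [if_neg hτ, if_pos (by rw [hs]; tauto)]
  · rw [if_neg hπ, hh3 p k hk3 hkn]
    by_cases hτ : 3 ≤ (τ 0).val
    · rw [if_pos hτ, if_pos (by rw [hs]; tauto)]
    · rw [if_neg hτ, if_neg (by rw [hs]; tauto)]

/-- Inverses. [cite: Fischler2002Polyzetas, §3 Théorème 3.2 (n ≥ 4)] -/
theorem rel4_inv {g : Perm {p : Exponents // InE n p}} {π : Perm (Fin 6)}
    (hg : (∀ x p, f x (g p).1 = f (π x) p.1) ∧ (∀ x : Fin 6, (π x).val < 3 ↔ (x.val < 3 ↔ (π 0).val < 3)) ∧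
      ∀ (p : {p : Exponents // InE n p}) (k : ℕ), 3 ≤ k → k ≤ n - 2 →
        (g p).1.a k = p.1.a (if 3 ≤ (π 0).val then n + 1 - k else k)) :
    (∀ x p, f x (g⁻¹ p).1 = f (π⁻¹ x) p.1) ∧ (∀ x : Fin 6, (π⁻¹ x).val < 3 ↔ (x.val < 3 ↔ (π⁻¹ 0).val < 3)) ∧
      ∀ (p : {p : Exponents // InE n p}) (k : ℕ), 3 ≤ k → k ≤ n - 2 →
        (g⁻¹ p).1.a k = p.1.a (if 3 ≤ (π⁻¹ 0).val then n + 1 - k else k) := by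
  obtain ⟨hg1, hg2, hg3⟩ := hg
  obtain ⟨hb, hs⟩ := blocks_inv hg2
  refine ⟨fun x p => ?_, hb, fun p k hk3 hkn => ?_⟩
  · have e := hg1 (π⁻¹ x) (g⁻¹ p)
    simp only [Perm.coe_inv, Equiv.apply_symm_apply] at e ⊢
    exact e.symm
  · by_cases hπ : 3 ≤ (π 0).val
    · have e := hg3 (g⁻¹ p) (n + 1 - k) (by omega) (by omega)
      rw [if_pos hπ, show n + 1 - (n + 1 - k) = k by omega] at e
      rw [if_pos (hs.2 hπ)]
      simp only [Perm.coe_inv, Equiv.apply_symm_apply] at e ⊢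
      exact e.symm
    · have e := hg3 (g⁻¹ p) k hk3 hkn
      rw [if_neg hπ] at e
      rw [if_neg (fun h => hπ (hs.1 h))]
      simp only [Perm.coe_inv, Equiv.apply_symm_apply] at e ⊢
      exact e.symm

include hf in
/-- **Every element of `⟨σ', ψ', φ'⟩` (`n ≥ 4`) acts on the six forms through some `π ∈ ⟨(0 2), (4 5), (0 3)(1 4)(2 5)⟩`, preserving
the blocks, and reverses the middle coordinates exactly when `π` exchanges the blocks.**
[cite: Fischler2002Polyzetas, §3 Théorème 3.2 (n ≥ 4)] -/
theorem exists_rel4_of_mem (hn : 4 ≤ n) (hσ : ∀ p, (gσ p).1 = sigma p.1) (hψ : ∀ p, (gψ p).1 = psi n p.1)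
    (hφ : ∀ p, (gφ p).1 = phi n p.1) {g : Perm {p : Exponents // InE n p}}
    (hg : g ∈ Subgroup.closure ({gσ, gψ, gφ} : Set (Perm {p : Exponents // InE n p}))) :
    ∃ π : Perm (Fin 6), π ∈ Subgroup.closure ({swap (0 : Fin 6) 2, swap (4 : Fin 6) 5,
        swap (0 : Fin 6) 3 * swap (1 : Fin 6) 4 * swap (2 : Fin 6) 5} : Set (Perm (Fin 6))) ∧
      (∀ x p, f x (g p).1 = f (π x) p.1) ∧ (∀ x : Fin 6, (π x).val < 3 ↔ (x.val < 3 ↔ (π 0).val < 3)) ∧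
      ∀ (p : {p : Exponents // InE n p}) (k : ℕ), 3 ≤ k → k ≤ n - 2 →
        (g p).1.a k = p.1.a (if 3 ≤ (π 0).val then n + 1 - k else k) := by
  induction hg using Subgroup.closure_induction with
  | mem x hx =>
    simp only [Set.mem_insert_iff, Set.mem_singleton_iff] at hx
    rcases hx with rfl | rfl | rfl
    · exact ⟨_, Subgroup.subset_closure (by simp), rel4_sigma hf hn hσ⟩
    · exact ⟨_, Subgroup.subset_closure (by simp), rel4_psi hf hn hψ⟩
    · exact ⟨_, Subgroup.subset_closure (by simp), rel4_phi hf hn hφ⟩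
  | one =>
    refine ⟨1, Subgroup.one_mem _, fun x p => rfl, fun x => by simp, fun p k hk3 hkn => ?_⟩
    rw [Perm.one_apply, Perm.one_apply, Fin.val_zero, if_neg (by norm_num)]
  | mul x y _ _ ihx ihy =>
    obtain ⟨π, hπ, hx⟩ := ihx
    obtain ⟨τ, hτ, hy⟩ := ihy
    exact ⟨τ * π, Subgroup.mul_mem _ hτ hπ, rel4_mul hx hy⟩
  | inv x _ ihx =>
    obtain ⟨π, hπ, hx⟩ := ihx
    exact ⟨π⁻¹, Subgroup.inv_mem _ hπ, rel4_inv hx⟩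

/-! ### Faithfulness -/

include hf in
/-- **Faithfulness (`n ≥ 4`).** An element of `⟨σ', ψ', φ'⟩` acting on the six forms through `1` is the identity: `a₁, a₂, a_{n−1}, a_n`
are forms, the middle `a_k` are not reversed (no block exchange), so all `a_k` are fixed; on `𝓔`, `b₁ = a₂`, `b₂` is a form, the
`b_k` (`3 ≤ k ≤ n`) follow by the chain relations `a_{k−2} + b_{k−1} = a_k + b_k`, `c_n` is a form, `c₂ = ⋯ = c_{n−1} = 0`, and the
remaining coordinates are inert. [cite: Fischler2002Polyzetas, §3 Théorème 3.2 (n ≥ 4)] -/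
theorem eq_one_of_rel4_one (hn : 4 ≤ n) (hσ : ∀ p, (gσ p).1 = sigma p.1) (hψ : ∀ p, (gψ p).1 = psi n p.1)
    (hφ : ∀ p, (gφ p).1 = phi n p.1) {g : Perm {p : Exponents // InE n p}}
    (hg : g ∈ Subgroup.closure ({gσ, gψ, gφ} : Set (Perm {p : Exponents // InE n p})))
    (h1 : ∀ x p, f x (g p).1 = f x p.1)
    (h3 : ∀ (p : {p : Exponents // InE n p}) (k : ℕ), 3 ≤ k → k ≤ n - 2 → (g p).1.a k = p.1.a k) : g = 1 := by
  refine Equiv.ext fun p => Subtype.ext ?_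
  rw [Perm.one_apply]
  obtain ⟨ha, hb, hc⟩ := inert4_of_mem hn hσ hψ hφ hg p
  obtain ⟨hc0, -, h4⟩ := p.2
  obtain ⟨hc0', -, h4'⟩ := (g p).2
  obtain ⟨h21, hbn, hch⟩ := h4 hn
  obtain ⟨h21', hbn', hch'⟩ := h4' hn
  have f0 := h1 0 p; have f1 := h1 1 p; have f2 := h1 2 p; have f3 := h1 3 p; have f4 := h1 4 p; have f5 := h1 5 p
  simp only [hf] at f0 f1 f2 f3 f4 f5
  simp only [Matrix.cons_val] at f0 f1 f2 f3 f4 f5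
  -- all `a_k` are fixed
  have haAll : ∀ k, (g p).1.a k = p.1.a k := by
    intro k
    by_cases hk0 : k = 0 ∨ n < k
    · exact ha k hk0
    · rcases Nat.lt_or_ge k 3 with hk | hk
      · interval_cases k
        · omega
        · exact f0
        · exact f1
      · by_cases hkm : k ≤ n - 2
        · exact h3 p k hk hkm
        · rcases (show k = n - 1 ∨ k = n by omega) with rfl | rfl
          · exact f4
          · exact f3
  -- the `b_k`, by the chain relations
  have hbAll : ∀ k, (g p).1.b k = p.1.b k := by
    intro k
    induction k using Nat.strong_induction_on with
    | _ k ih =>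
      by_cases hk0 : k = 0 ∨ n < k
      · exact hb k hk0
      · rcases Nat.lt_or_ge k 3 with hk | hk
        · interval_cases k
          · omega
          · rw [← h21, ← h21', haAll]
          · exact f2
        · have e := hch (k - 2) (by omega) (by omega)
          have e' := hch' (k - 2) (by omega) (by omega)
          rw [show k - 2 + 1 = k - 1 by omega, show k - 2 + 2 = k by omega] at e e'
          have ihk := ih (k - 1) (by omega)
          rw [haAll, haAll] at e'
          linarith
  refine exponents_eq haAll hbAll (fun k => ?_)
  by_cases hk : k ≤ 1 ∨ n < k
  · exact hc k hk
  · by_cases hkn : k = n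
    · subst hkn; exact f5
    · rw [hc0 k (by omega) (by omega), hc0' k (by omega) (by omega)]

/-! ### The permutation `π` is unique -/

include hf in
/-- **Uniqueness of `π` (`n ≥ 4`).** At the point of `𝓔` with `a = (1, 2, 0, …, 0, 4, 8)`, `b₁ = 2`, `b₂ = 16`,
`b_k = 19 − a_{k−1} − a_k` (`3 ≤ k ≤ n`), `c_n = b_n = 7` the six forms take the distinct values `1, 2, 16, 8, 4, 7`.
[cite: Fischler2002Polyzetas, §3 Théorème 3.2 (n ≥ 4)] -/
theorem rel4_unique (hn : 4 ≤ n) {g : Perm {p : Exponents // InE n p}} {π π' : Perm (Fin 6)}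
    (hπ : ∀ x p, f x (g p).1 = f (π x) p.1) (hπ' : ∀ x p, f x (g p).1 = f (π' x) p.1) : π = π' := by
  let A : ℕ → ℤ := fun k => if k = 1 then 1 else if k = 2 then 2 else if k = n - 1 then 4 else if k = n then 8 else 0
  have hA1 : A 1 = 1 := by simp [A]
  have hA2 : A 2 = 2 := by simp [A]
  have hAn : A n = 8 := by simp [A, show n ≠ 1 by omega, show n ≠ 2 by omega, show n ≠ n - 1 by omega]
  have hAm : A (n - 1) = 4 := by simp [A, show n - 1 ≠ 1 by omega, show n - 1 ≠ 2 by omega]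
  let B : ℕ → ℤ := fun k => if k = 1 then 2 else if k = 2 then 16 else if 3 ≤ k ∧ k ≤ n then 19 - A (k - 1) - A k else 0
  let C : ℕ → ℤ := fun k => if k = n then 19 - A (n - 1) - A n else 0
  have hB1 : B 1 = 2 := by simp [B]
  have hB2 : B 2 = 16 := by simp [B]
  have hB3 : ∀ k, 3 ≤ k → k ≤ n → B k = 19 - A (k - 1) - A k := fun k hk hkn => by
    simp [B, show k ≠ 1 by omega, show k ≠ 2 by omega, hk, hkn]
  have hCn : C n = 7 := by simp [C, hAn, hAm]
  have hp₀ : InE n ⟨A, B, C⟩ := by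
    refine ⟨fun k hk hk' => ?_, fun h => by omega, fun _ => ⟨?_, ?_, fun k hk1 hkn => ?_⟩⟩
    · show C k = 0
      simp [C, show k ≠ n by omega]
    · show A 2 = B 1
      rw [hA2, hB1]
    · show B n = C n
      rw [hB3 n (by omega) le_rfl, hCn, hAm, hAn]; norm_num
    · show A k + B (k + 1) = A (k + 2) + B (k + 2)
      rw [hB3 (k + 2) (by omega) (by omega), show k + 2 - 1 = k + 1 from rfl]
      by_cases hk1' : k = 1
      · subst hk1'
        rw [hB2, hA1, hA2]; ring
      · rw [hB3 (k + 1) (by omega) (by omega), show k + 1 - 1 = k from rfl]; ring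
  let p₀ : {p : Exponents // InE n p} := ⟨⟨A, B, C⟩, hp₀⟩
  have hv : ∀ x : Fin 6, f x p₀.1 = ![(1 : ℤ), 2, 16, 8, 4, 7] x := by
    intro x
    fin_cases x
    · simpa [hf, p₀] using hA1
    · simpa [hf, p₀] using hA2
    · simpa [hf, p₀] using hB2
    · simpa [hf, p₀] using hAn
    · simpa [hf, p₀] using hAm
    · simpa [hf, p₀] using hCn
  have hinj : Function.Injective (![(1 : ℤ), 2, 16, 8, 4, 7] : Fin 6 → ℤ) := by decide
  ext x : 1
  have e := (hπ x p₀).symm.trans (hπ' x p₀)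
  rw [hv, hv] at e
  exact hinj e

/-! ### The order `72` -/

include hf in
/-- **For `n ≥ 4`, `|⟨σ', ψ', φ'⟩| = 72`**, via the injective homomorphism `ρ : g ↦ π_g⁻¹` onto
`⟨(0 2), (4 5), (0 3)(1 4)(2 5)⟩ ≤ 𝔖₆` (`card_closure_wreath`). [cite: Fischler2002Polyzetas, §3 Théorème 3.2 (n ≥ 4)]
[cite: Fischler2003RhinViola, §3.4 Théorème 6 p. 515 (ordre 72)] -/
theorem card_closure_eq_of_four_le_aux (hn : 4 ≤ n) (hσ : ∀ p, (gσ p).1 = sigma p.1) (hψ : ∀ p, (gψ p).1 = psi n p.1)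
    (hφ : ∀ p, (gφ p).1 = phi n p.1) :
    Nat.card (Subgroup.closure ({gσ, gψ, gφ} : Set (Perm {p : Exponents // InE n p}))) = 72 := by
  set G := Subgroup.closure ({gσ, gψ, gφ} : Set (Perm {p : Exponents // InE n p})) with hG
  set K := Subgroup.closure ({swap (0 : Fin 6) 2, swap (4 : Fin 6) 5,
      swap (0 : Fin 6) 3 * swap (1 : Fin 6) 4 * swap (2 : Fin 6) 5} : Set (Perm (Fin 6))) with hK
  have hex := fun g : G => exists_rel4_of_mem hf hn hσ hψ hφ g.2
  choose πf hπK hπf hπb hπm using hex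
  let ρ : G →* Perm (Fin 6) :=
    { toFun := fun g => (πf g)⁻¹
      map_one' := by
        have h1 : ∀ x p, f x ((1 : G).1 p).1 = f ((1 : Perm (Fin 6)) x) p.1 := fun x p => rfl
        rw [rel4_unique hf hn (hπf 1) h1, inv_one]
      map_mul' := fun g h => by
        have hm := (rel4_mul ⟨hπf g, hπb g, hπm g⟩ ⟨hπf h, hπb h, hπm h⟩).1
        rw [← mul_inv_rev, ← rel4_unique hf hn (hπf (g * h)) hm] }
  have hρ : ∀ g : G, ρ g = (πf g)⁻¹ := fun g => rfl
  have hinj : Function.Injective ρ := by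
    refine (injective_iff_map_eq_one ρ).2 fun g hg => ?_
    rw [hρ, inv_eq_one] at hg
    have h1 : ∀ x p, f x (g.1 p).1 = f x p.1 := fun x p => by rw [hπf g x p, hg, Perm.one_apply]
    have h3 : ∀ (p : {p : Exponents // InE n p}) (k : ℕ), 3 ≤ k → k ≤ n - 2 → (g.1 p).1.a k = p.1.a k := by
      intro p k hk3 hkn
      rw [hπm g p k hk3 hkn, hg, Perm.one_apply, Fin.val_zero, if_neg (by norm_num)]
    exact Subtype.ext (eq_one_of_rel4_one hf hn hσ hψ hφ g.2 h1 h3)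
  have hσmem : gσ ∈ G := Subgroup.subset_closure (by simp)
  have hψmem : gψ ∈ G := Subgroup.subset_closure (by simp)
  have hφmem : gφ ∈ G := Subgroup.subset_closure (by simp)
  have eσ : ρ ⟨gσ, hσmem⟩ = swap (0 : Fin 6) 2 := by
    rw [hρ, rel4_unique hf hn (hπf ⟨gσ, hσmem⟩) (rel4_sigma hf hn hσ).1, swap_inv]
  have eφ : ρ ⟨gφ, hφmem⟩ = swap (4 : Fin 6) 5 := by
    rw [hρ, rel4_unique hf hn (hπf ⟨gφ, hφmem⟩) (rel4_phi hf hn hφ).1, swap_inv]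
  have eψ : ρ ⟨gψ, hψmem⟩ = swap (0 : Fin 6) 3 * swap (1 : Fin 6) 4 * swap (2 : Fin 6) 5 := by
    rw [hρ, rel4_unique hf hn (hπf ⟨gψ, hψmem⟩) (rel4_psi hf hn hψ).1]; decide
  have hrange : ρ.range = K := by
    refine le_antisymm ?_ ?_
    · rintro _ ⟨g, rfl⟩
      rw [hρ]
      exact K.inv_mem (hπK g)
    · rw [hK, Subgroup.closure_le]
      rintro x hx
      simp only [Set.mem_insert_iff, Set.mem_singleton_iff] at hx
      rcases hx with rfl | rfl | rfl
      · exact ⟨_, eσ⟩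
      · exact ⟨_, eφ⟩
      · exact ⟨_, eψ⟩
  rw [Nat.card_congr (MonoidHom.ofInjective hinj).toEquiv, hrange]
  exact card_closure_wreath

end OrderFour

/-- **Fischler's Théorème 3.2 for `n ≥ 4`, the ORDER: `|⟨σ', ψ', φ'⟩| = 72 = rvGroupOrder n`** for any permutations `σ', ψ', φ'` of
`{p // p ∈ 𝓔}` with underlying maps `sigma`, `psi n`, `phi n` (they exist: `exists_perms`), uniformly in `n ≥ 4`. The typed isomorphism
type `(𝔖₃ × 𝔖₃) ⋊ ℤ/2ℤ` is realised as `𝔖₃ ≀ ℤ/2 ≤ 𝔖₆` acting on the six forms (`card_closure_eq_of_four_le_aux`). With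
`card_closure_eq_two` and `card_closure_eq_three`, `Nat.card ⟨σ',ψ',φ'⟩ = rvGroupOrder n` now holds for every `n ≥ 2`.
[cite: Fischler2002Polyzetas, §3 Théorème 3.2 (n ≥ 4)] [cite: Fischler2003RhinViola, §3.4 Théorème 6 p. 515] -/
theorem card_closure_eq_of_four_le {n : ℕ} (hn : 4 ≤ n) {gσ gψ gφ : Perm {p : Exponents // InE n p}}
    (hσ : ∀ p, (gσ p).1 = sigma p.1) (hψ : ∀ p, (gψ p).1 = psi n p.1) (hφ : ∀ p, (gφ p).1 = phi n p.1) :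
    Nat.card (Subgroup.closure ({gσ, gψ, gφ} : Set (Perm {p : Exponents // InE n p}))) = rvGroupOrder n := by
  obtain ⟨f, hf⟩ : ∃ f : Fin 6 → Exponents → ℤ, ∀ (x : Fin 6) (p : Exponents),
      f x p = ![p.a 1, p.a 2, p.b 2, p.a n, p.a (n - 1), p.c n] x := ⟨_, fun _ _ => rfl⟩
  rw [card_closure_eq_of_four_le_aux hf hn hσ hψ hφ, rvGroupOrder, if_neg (by omega), if_neg (by omega)]

/-- **The ORDER clause of Théorème 3.2 for every `n ≥ 2`**: `Nat.card ⟨σ', ψ', φ'⟩ = rvGroupOrder n` (`120 / 1920 / 72`).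
[cite: Fischler2002Polyzetas, §3 Théorème 3.2] [cite: Fischler2003RhinViola, §3.4 Théorème 6 p. 515] -/
theorem card_closure_eq {n : ℕ} (hn : 2 ≤ n) {gσ gψ gφ : Perm {p : Exponents // InE n p}}
    (hσ : ∀ p, (gσ p).1 = sigma p.1) (hψ : ∀ p, (gψ p).1 = psi n p.1) (hφ : ∀ p, (gφ p).1 = phi n p.1) :
    Nat.card (Subgroup.closure ({gσ, gψ, gφ} : Set (Perm {p : Exponents // InE n p}))) = rvGroupOrder n := by
  rcases Nat.lt_or_ge n 4 with h | h
  · interval_cases n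
    · exact card_closure_eq_two hσ hψ hφ
    · exact card_closure_eq_three hσ hψ hφ
  · exact card_closure_eq_of_four_le h hσ hψ hφ

end Theoreme32

end Literature.NumberTheory.Irrationality.Fischler2002
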